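import Mathlib
import Summits.KontsevichZagierPeriods.Zeta5Search.ClassDigitLaw
import Summits.KontsevichZagierPeriods.Zeta5Search.LeadingDigitProof
import Summits.KontsevichZagierPeriods.Zeta5Search.ClusterValuationResidues
import HarnessLib

/-!
# ζ(5) search — CLASS-DIGIT LAW, proofs I: dictionary, pole expansion, integralities, depth-`N` congruences

Cell `pub-zeta5`, track DENOM-LAW (D1; statements denom-theory-d1 g3/g4, proofs denom-theory-d1 g5, filed by denom-prover-d1 g4).
HONEST FRAMING: systematic search; identities and `p`-adic valuations of the cell's own partial-fraction coefficients
`c_{σ−1,q}` (rational numbers) in the window `p² > b₀ + 2`; nothing about ζ(5); no irrationality claim; records in print UNMOVED.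

This file proves the statements `ForeignSeriesDict`, `PoleExpansion`, `ForeignIntegrality`, `ClassIntegrality`, `TopCoefficient`,
`DepthCongruenceU`, `DepthCongruenceW`, `PoleCoeffGser` of `ClassDigitLaw.lean` (each as `theorem …_holds : <Decl>`), verbatim from the
certified scratch monolith `denom-law/code/d1g5/lean/ClassDigitLawProof5.lean` (sha256 3ec15a59…).  Architecture (denom-theory-d1 g4's
PROOF PLAN): the one new identity is the DICTIONARY `foreignSeries b p q = rescale (−p) (Gfar b p q)`; `PoleExpansion` is
`pf_eq_coeff_Gser` + `Gser_eq_near_mul_far` + `rescale_Gnear` + the dictionary; the integralities are `Gfar_integral` / `Gnear_bound`;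
the depth-`N` congruences are `PoleExpansion` + `coeff_trunc` + the two integralities summed over the poles (`padicNorm.sum_le'`).
The valuation/norm conversions `padicNorm_le_of_val` / `val_ge_of_padicNorm_le` are the tree's (`ClusterValuationResidues`), not re-declared.
The first-digit congruences and `LeadingDigitV` are in `ClassDigitLawDigits.lean`, the second digit in `ClassDigitLawSecondDigit.lean`.
-/

noncomputable section

open Finset PowerSeries

namespace Summit.KontsevichZagierPeriods.Zeta5Search.ClassDigitLaw

open Summit.KontsevichZagierPeriods.Zeta5Search.DualSeries (InBox)
open Summit.KontsevichZagierPeriods.Zeta5Search.CasoratianValuation (InPolytope)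
open Summit.KontsevichZagierPeriods.Zeta5Search.WedgeDictionary (coeffU coeffW pfData)
open Summit.KontsevichZagierPeriods.Zeta5Search.ClusterValuation
open Summit.KontsevichZagierPeriods.Zeta5Search.PadicSeries
open Literature.NumberTheory.Transcendental.BallRivoal (harm)

/-! ## The dictionary: `foreignSeries = rescale (−p) Gfar` -/

/-- `(2 : ℚ⟦X⟧) = C 2`. -/
theorem two_eq_C : (2 : PowerSeries ℚ) = C (2 : ℚ) := (map_ofNat C 2).symm

/-- **The dictionary lemma**: `foreignSeries b p q = Gfar b p q (−pX)`. -/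
theorem foreignSeries_eq_rescale_Gfar (b : ℕ → ℤ) {p q : ℕ} (hprime : p.Prime) (h0 : 0 ≤ b 0)
    (hq : q ≤ (b 0).toNat) : foreignSeries b p q = rescale (-(p : ℚ)) (Gfar b p q) := by
  have hp0 : p ≠ 0 := hprime.ne_zero
  have hb0 : ((((b 0).toNat : ℕ) : ℚ)) = ((b 0 : ℤ) : ℚ) := by exact_mod_cast Int.toNat_of_nonneg h0
  -- the product of the far factors
  have hprod : rescale (-(p : ℚ)) (∏ s ∈ ((range ((b 0).toNat + 1)).erase q).filter
      (fun s : ℕ => ¬ (p : ℤ) ∣ (s : ℤ) - q), factorS b q s) =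
      ∏ s ∈ (range ((b 0).toNat + 1)).filter (fun s => s % p ≠ q % p),
        rescale (-(p : ℚ)) (binomSeries ((s : ℚ) - q) (netExp b s)) := by
    rw [map_prod, farSet_eq b hq]
    refine prod_congr rfl fun s hs => ?_
    have hsq : s ≠ q := (mem_erase.1 (mem_filter.1 hs).1).1
    have hδ : ((s : ℚ) - q) ≠ 0 := sub_ne_zero.2 (by exact_mod_cast hsq)
    have hm : ((mult b s : ℕ) : ℤ) - 6 = netExp b s := by have := mult_eq_netExp b s; omega
    rw [factorS, linS, linS_pow_mul_inv_eq_binomSeries hδ, hm]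
  rw [foreignSeries, Gfar, map_mul, hprod]
  by_cases hc : ¬ (2 : ℤ) ∣ b 0 ∧ CentreIn b p q
  · rw [if_pos hc, if_neg (fun h : ¬ (2 : ℤ) ∣ b 0 ∧ ¬ CentreIn b p q => h.2 hc.2), rescale_C', mul_one, two_eq_C]
  · rw [if_neg hc]
    by_cases hev : (2 : ℤ) ∣ b 0
    · rw [if_neg (fun h : ¬ (2 : ℤ) ∣ b 0 ∧ ¬ CentreIn b p q => h.1 hev), cenP, if_pos hev, Polynomial.coe_C,
        rescale_C', mul_one, two_eq_C]
    · have hnc : ¬ CentreIn b p q := fun h => hc ⟨hev, h⟩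
      have hδ : ((b 0 : ℚ) / 2 - q) ≠ 0 := by
        intro h
        have h2 : ((b 0 : ℤ) : ℚ) = 2 * q := by linarith
        exact hev ⟨q, by exact_mod_cast h2⟩
      rw [if_pos ⟨hev, hnc⟩, cenP, if_neg hev, Polynomial.coe_add, Polynomial.coe_mul, Polynomial.coe_C,
        Polynomial.coe_X, Polynomial.coe_C, binomSeries_one hδ, rescale_X_add_C, map_add, map_mul, rescale_C',
        rescale_X, rescale_C', hb0, two_eq_C]
      have hC : C ((((b 0 : ℤ) : ℚ)) - 2 * q) = C (2 : ℚ) * C (((b 0 : ℤ) : ℚ) / 2 - q) := by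
        rw [← map_mul]; congr 1; ring
      rw [hC]; ring

/-- **`ForeignSeriesDict` is a theorem.** -/
theorem foreignSeriesDict_holds : ForeignSeriesDict := fun b _ _ hprime h0 hq =>
  foreignSeries_eq_rescale_Gfar b hprime h0 hq

/-! ## The pole expansion -/

/-- The pole expansion with tree hypotheses (`InBox`, halves, any partial-fraction data). -/
theorem pf_eq_poleExpansion (b : ℕ → ℤ) {p : ℕ} (hprime : p.Prime) (hbox : InBox b)
    (hhalf : ∀ j ∈ range 7, 2 * b (j + 1) ≤ b 0 + 1) {c : ℕ → ℕ → ℚ}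
    (hc : Summit.KontsevichZagierPeriods.Zeta5Search.WedgeDictionary.IsPFData b c) {q : ℕ} (hq : q ≤ (b 0).toNat)
    {σ : ℕ} (hσ1 : 1 ≤ σ) (hσ : (σ : ℤ) ≤ -netExp b q) :
    c (σ - 1) q = (-(p : ℚ)) ^ ((σ : ℤ) + classExp b p q) *
      coeff ((-netExp b q).toNat - σ) (classCofactor b p q * foreignSeries b p q) := by
  have h0 : 0 ≤ b 0 := hbox.1
  have hp0 : p ≠ 0 := hprime.ne_zero
  have hp' : (-(p : ℚ)) ≠ 0 := neg_ne_zero.2 (Nat.cast_ne_zero.2 hp0)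
  have hm := mult_eq_netExp b q
  have hid := pf_eq_coeff_Gser b hbox hhalf hc hq (show σ - 1 < 6 by omega)
  rw [coeff_X_pow_mul', if_pos (by omega)] at hid
  set κ := 5 - (σ - 1) - mult b q with hκ
  have hκN : (-netExp b q).toNat - σ = κ := by omega
  have hres := congrArg (coeff κ) (congrArg (rescale (-(p : ℚ))) (Gser_eq_near_mul_far b p q))
  rw [map_mul, rescale_Gnear hp0 b h0 hq, ← foreignSeries_eq_rescale_Gfar b hprime h0 hq, coeff_rescale, mul_assoc,
    coeff_C_mul] at hres
  -- hres : (-p)^κ * coeff κ (Gser b q) = (-p)^(E - e_q) * coeff κ (classCofactor * foreignSeries)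
  rw [hid, hκN]
  have e1 : (-(p : ℚ)) ^ κ = (-(p : ℚ)) ^ (κ : ℤ) := (zpow_natCast _ _).symm
  rw [e1] at hres
  have hκ0 : (-(p : ℚ)) ^ (κ : ℤ) ≠ 0 := zpow_ne_zero _ hp'
  rw [← mul_right_inj' hκ0, hres, ← mul_assoc, ← zpow_add₀ hp']
  congr 2
  omega

/-- **`PoleExpansion` is a theorem.** -/
theorem poleExpansion_holds : PoleExpansion := by
  intro b p q σ hb hprime _hp5 hwin hq hσ1 hσ
  obtain ⟨hbox, hhalf, hpf, _hn⟩ := thmA_data b hb hwin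
  exact pf_eq_poleExpansion b hprime hbox hhalf hpf hq hσ1 hσ

/-! ## Valuation helpers -/

/-- `v_p((−p)^z) = z`. -/
theorem padicValRat_negp_zpow {p : ℕ} [hp : Fact p.Prime] (z : ℤ) : padicValRat p ((-(p : ℚ)) ^ z) = z := by
  rw [padicValRat.zpow, padicValRat.neg, padicValRat.self hp.out.one_lt, mul_one]

/-- `v_p((−p)^k) = k`. -/
theorem padicValRat_negp_pow {p : ℕ} [hp : Fact p.Prime] (k : ℕ) : padicValRat p ((-(p : ℚ)) ^ k) = k := by
  rw [padicValRat.pow, padicValRat.neg, padicValRat.self hp.out.one_lt, mul_one]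

/-- `‖(−p)^z‖_p = p^{−z}`. -/
theorem padicNorm_negp_zpow {p : ℕ} [hp : Fact p.Prime] (z : ℤ) : padicNorm p ((-(p : ℚ)) ^ z) = (p : ℚ) ^ (-z) := by
  have hp' : (-(p : ℚ)) ≠ 0 := neg_ne_zero.2 (Nat.cast_ne_zero.2 hp.out.ne_zero)
  rw [padicNorm.eq_zpow_of_nonzero (zpow_ne_zero _ hp'), padicValRat_negp_zpow]

/-! ## The two integralities -/

/-- **`ForeignIntegrality` is a theorem**: `v_p([ε^j] g_{x,q}) ≥ j` (`= j + v_p([X^j] Gfar)`, `Gfar` `p`-integral). -/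
theorem foreignIntegrality_holds : ForeignIntegrality := by
  intro b p q j hb hprime _hp5 hwin hq hne
  haveI : Fact p.Prime := ⟨hprime⟩
  obtain ⟨hbox, _hhalf, _hpf, hn⟩ := thmA_data b hb hwin
  have h0 : 0 ≤ b 0 := hbox.1
  have hp2 : p ≠ 2 := by omega
  have hp' : (-(p : ℚ)) ≠ 0 := neg_ne_zero.2 (Nat.cast_ne_zero.2 hprime.ne_zero)
  rw [foreignSeries_eq_rescale_Gfar b hprime h0 hq, coeff_rescale] at hne ⊢
  have hG : coeff j (Gfar b p q) ≠ 0 := fun h => hne (by rw [h, mul_zero])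
  have hv := (Gfar_integral b hq hn hp2).le_padicValRat hG
  rw [padicValRat.mul (pow_ne_zero _ hp') hG, padicValRat_negp_pow]
  simp only [zero_mul, sub_zero] at hv
  linarith

/-- **`ClassIntegrality` is a theorem**: `[ε^i] G_q = (−p)^{−(E−e_q)}·(−p)^i·[X^i] Gnear` and `Gnear` has slope-`1`
offset `E − e_q`. -/
theorem classIntegrality_holds : ClassIntegrality := by
  intro b p q i hb hprime _hp5 hwin hq hne
  haveI : Fact p.Prime := ⟨hprime⟩
  obtain ⟨hbox, _hhalf, _hpf, hn⟩ := thmA_data b hb hwin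
  have h0 : 0 ≤ b 0 := hbox.1
  have hp2 : p ≠ 2 := by omega
  have hp0 : p ≠ 0 := hprime.ne_zero
  have hp' : (-(p : ℚ)) ≠ 0 := neg_ne_zero.2 (Nat.cast_ne_zero.2 hp0)
  have hres := congrArg (coeff i) (rescale_Gnear hp0 b h0 hq)
  rw [coeff_rescale, coeff_C_mul] at hres
  -- hres : (-p)^i * coeff i Gnear = (-p)^(E - e_q) * coeff i classCofactor
  have hG : coeff i (Gnear b p q) ≠ 0 := by
    intro h
    rw [h, mul_zero] at hres
    exact hne ((mul_eq_zero.1 hres.symm).resolve_left (zpow_ne_zero _ hp'))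
  have hv := (Gnear_bound b h0 hq hn hp2).le_padicValRat hG
  have hval := congrArg (padicValRat p) hres
  rw [padicValRat.mul (pow_ne_zero _ hp') hG, padicValRat.mul (zpow_ne_zero _ hp') hne, padicValRat_negp_pow,
    padicValRat_negp_zpow] at hval
  linarith

/-- Slope-`0` form: in the window the class cofactor has `p`-integral coefficients. -/
theorem classCofactor_integral (b : ℕ → ℤ) {p : ℕ} (hb : InPolytope b) (hprime : p.Prime) (hp5 : 5 ≤ p)
    (hwin : (b 0 + 2 : ℤ) < (p : ℤ) ^ 2) {q : ℕ} (hq : q ≤ (b 0).toNat) :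
    CoeffBound p 0 0 (classCofactor b p q) := by
  haveI : Fact p.Prime := ⟨hprime⟩
  intro k
  have h := padicNorm_le_of_val (p := p) (m := 0)
    (fun hk => classIntegrality_holds b p q k hb hprime hp5 hwin hq hk)
  simpa using h

/-- The constant term of the foreign series is gen-2's unit `ĝ_q`. -/
theorem constantCoeff_foreignSeries (b : ℕ → ℤ) {p q : ℕ} (hprime : p.Prime) (h0 : 0 ≤ b 0)
    (hq : q ≤ (b 0).toNat) : constantCoeff (foreignSeries b p q) = gHat b p q := by
  rw [foreignSeries_eq_rescale_Gfar b hprime h0 hq, ← coeff_zero_eq_constantCoeff_apply, coeff_rescale, pow_zero,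
    one_mul, coeff_zero_eq_constantCoeff_apply, constantCoeff_Gfar b h0 hq]

/-! ## The top coefficient -/

/-- **`TopCoefficient` is a theorem** (the case `σ = n_q` of the pole expansion: `[ε^0](G_q·g) = ρ_{q,n_q}·ĝ_q`). -/
theorem topCoefficient_holds : TopCoefficient := by
  intro b p q hb hprime _hp5 hwin hq hpole
  obtain ⟨hbox, hhalf, hpf, _hn⟩ := thmA_data b hb hwin
  have h0 : 0 ≤ b 0 := hbox.1
  have h := pf_eq_poleExpansion b hprime hbox hhalf hpf hq (σ := (-netExp b q).toNat) (by omega) (by omega)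
  rw [h, Nat.sub_self, classRho, Nat.sub_self]
  simp only [coeff_zero_eq_constantCoeff_apply, map_mul, constantCoeff_foreignSeries b hprime h0 hq]
  have e : (((-netExp b q).toNat : ℕ) : ℤ) = -netExp b q := by omega
  rw [e]; ring

/-! ## The depth-`N` congruence -/

/-- The truncation remainder of the foreign series: `‖[ε^k](g − trunc_N g)‖_p ≤ p^{−N}`. -/
theorem foreignRemainder_bound (N : ℕ) (b : ℕ → ℤ) {p : ℕ} (hb : InPolytope b) (hprime : p.Prime) (hp5 : 5 ≤ p)
    (hwin : (b 0 + 2 : ℤ) < (p : ℤ) ^ 2) {q : ℕ} (hq : q ≤ (b 0).toNat) :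
    CoeffBound p 0 N (foreignSeries b p q - ((trunc N (foreignSeries b p q) : Polynomial ℚ) : PowerSeries ℚ)) := by
  haveI : Fact p.Prime := ⟨hprime⟩
  intro k
  rw [map_sub, Polynomial.coeff_coe, coeff_trunc]
  split_ifs with hk
  · rw [sub_self, padicNorm.zero]; exact zpow_p_nonneg _
  · rw [sub_zero]
    have hk' := not_lt.1 hk
    have h := padicNorm_le_of_val (p := p) (m := (k : ℤ))
      (fun hk0 => foreignIntegrality_holds b p q k hb hprime hp5 hwin hq hk0)
    refine h.trans (zpow_le_zpow_right₀ one_le_p ?_)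
    simp only [zero_mul, zero_sub]
    omega

/-- One pole's contribution beyond depth `N`: `‖c_{σ−1,q} − truncPole N‖_p ≤ p^{−(σ + E_q + N)}`. -/
theorem pole_sub_truncPole_bound (N : ℕ) (b : ℕ → ℤ) {p : ℕ} (hb : InPolytope b) (hprime : p.Prime) (hp5 : 5 ≤ p)
    (hwin : (b 0 + 2 : ℤ) < (p : ℤ) ^ 2) {q : ℕ} (hq : q ≤ (b 0).toNat) {σ : ℕ} (hσ1 : 1 ≤ σ)
    (hσ : (σ : ℤ) ≤ -netExp b q) :
    padicNorm p (pfData b (σ - 1) q - truncPole N b p q σ) ≤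
      (p : ℚ) ^ (-(((σ : ℤ) + classExp b p q) + N)) := by
  haveI : Fact p.Prime := ⟨hprime⟩
  have hprod := (classCofactor_integral b hb hprime hp5 hwin hq).mul (foreignRemainder_bound N b hb hprime hp5 hwin hq)
  have hk := hprod ((-netExp b q).toNat - σ)
  have e : (-(p : ℚ)) ^ ((σ : ℤ) + classExp b p q) *
        coeff ((-netExp b q).toNat - σ) (classCofactor b p q * foreignSeries b p q) -
      (-(p : ℚ)) ^ ((σ : ℤ) + classExp b p q) *
        coeff ((-netExp b q).toNat - σ)
          (classCofactor b p q * ((trunc N (foreignSeries b p q) : Polynomial ℚ) : PowerSeries ℚ)) =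
      (-(p : ℚ)) ^ ((σ : ℤ) + classExp b p q) *
        coeff ((-netExp b q).toNat - σ) (classCofactor b p q *
          (foreignSeries b p q - ((trunc N (foreignSeries b p q) : Polynomial ℚ) : PowerSeries ℚ))) := by
    rw [mul_sub, map_sub, mul_sub]
  rw [poleExpansion_holds b p q σ hb hprime hp5 hwin hq hσ1 hσ, truncPole, e, padicNorm.mul, padicNorm_negp_zpow]
  calc (p : ℚ) ^ (-((σ : ℤ) + classExp b p q)) * padicNorm p (coeff ((-netExp b q).toNat - σ)
        (classCofactor b p q *
          (foreignSeries b p q - ((trunc N (foreignSeries b p q) : Polynomial ℚ) : PowerSeries ℚ))))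
      ≤ (p : ℚ) ^ (-((σ : ℤ) + classExp b p q)) *
          (p : ℚ) ^ ((0 : ℤ) * (((-netExp b q).toNat - σ : ℕ) : ℤ) - (0 + N)) :=
        mul_le_mul_of_nonneg_left hk (zpow_p_nonneg _)
    _ = (p : ℚ) ^ (-(((σ : ℤ) + classExp b p q) + N)) := by
        rw [← zpow_add₀ (Nat.cast_ne_zero.2 hprime.ne_zero)]
        congr 1
        ring

/-- Non-poles and poles of order `< σ` contribute nothing to the order-`σ` coefficient: `c_{σ−1,q} = 0`. -/
theorem pfData_eq_zero_of_lt (b : ℕ → ℤ) {p : ℕ} (hb : InPolytope b) (hwin : (b 0 + 2 : ℤ) < (p : ℤ) ^ 2) {q : ℕ}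
    (hq : q ≤ (b 0).toNat) {σ : ℕ} (hσ1 : 1 ≤ σ) (hσ6 : σ ≤ 6) (hlt : ¬ netExp b q ≤ -(σ : ℤ)) :
    pfData b (σ - 1) q = 0 := by
  obtain ⟨hbox, hhalf, hpf, _hn⟩ := thmA_data b hb hwin
  have hid := pf_eq_coeff_Gser b hbox hhalf hpf hq (show σ - 1 < 6 by omega)
  rw [coeff_X_pow_mul'] at hid
  have hmq := mult_eq_netExp b q
  rw [if_neg (by omega)] at hid
  exact hid

/-- **The depth-`N` congruence for the order-`σ` coefficient sum `Σ_{q ≤ b₀} c_{σ−1,q}`** (`σ = 5`: `U`; `σ = 3`: `W`). -/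
theorem depthCongruence (N : ℕ) (b : ℕ → ℤ) {p : ℕ} (m : ℤ) {σ : ℕ} (hb : InPolytope b) (hprime : p.Prime)
    (hp5 : 5 ≤ p) (hwin : (b 0 + 2 : ℤ) < (p : ℤ) ^ 2) (hσ1 : 1 ≤ σ) (hσ6 : σ ≤ 6)
    (hm : ∀ q, q ≤ (b 0).toNat → netExp b q ≤ -(σ : ℤ) → m ≤ (σ : ℤ) + classExp b p q)
    (hne : (∑ q ∈ range ((b 0).toNat + 1), pfData b (σ - 1) q) - depthSum N b p σ ≠ 0) :
    m + N ≤ padicValRat p ((∑ q ∈ range ((b 0).toNat + 1), pfData b (σ - 1) q) - depthSum N b p σ) := by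
  haveI : Fact p.Prime := ⟨hprime⟩
  have hzero : ∀ q ∈ range ((b 0).toNat + 1), pfData b (σ - 1) q ≠ 0 → netExp b q ≤ -(σ : ℤ) := by
    intro q hq hne0
    by_contra hlt
    exact hne0 (pfData_eq_zero_of_lt b hb hwin (Nat.lt_succ_iff.1 (mem_range.1 hq)) hσ1 hσ6 hlt)
  have hsum : (∑ q ∈ range ((b 0).toNat + 1), pfData b (σ - 1) q) =
      ∑ q ∈ (range ((b 0).toNat + 1)).filter (fun q => netExp b q ≤ -(σ : ℤ)), pfData b (σ - 1) q :=
    (sum_filter_of_ne hzero).symm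
  rw [hsum, depthSum, ← sum_sub_distrib] at hne ⊢
  refine val_ge_of_padicNorm_le hne (padicNorm.sum_le' (fun q hq => ?_) (zpow_p_nonneg _))
  obtain ⟨hqr, hqσ⟩ := mem_filter.1 hq
  have hq' : q ≤ (b 0).toNat := Nat.lt_succ_iff.1 (mem_range.1 hqr)
  refine (pole_sub_truncPole_bound N b hb hprime hp5 hwin hq' hσ1 (by omega)).trans
    (zpow_le_zpow_right₀ one_le_p ?_)
  have := hm q hq' hqσ
  omega

/-- **`DepthCongruenceU` is a theorem.** -/
theorem depthCongruenceU_holds : DepthCongruenceU := by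
  intro N b p m hb hprime hp5 hwin hm hne
  have hm' : ∀ q, q ≤ (b 0).toNat → netExp b q ≤ -((5 : ℕ) : ℤ) → m ≤ ((5 : ℕ) : ℤ) + classExp b p q :=
    fun q hq h => by have := hm q hq (by exact_mod_cast h); exact_mod_cast this
  exact depthCongruence N b m (σ := 5) hb hprime hp5 hwin (by norm_num) (by norm_num) hm' hne

/-- **`DepthCongruenceW` is a theorem.** -/
theorem depthCongruenceW_holds : DepthCongruenceW := by
  intro N b p m hb hprime hp5 hwin hm hne
  have hm' : ∀ q, q ≤ (b 0).toNat → netExp b q ≤ -((3 : ℕ) : ℤ) → m ≤ ((3 : ℕ) : ℤ) + classExp b p q :=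
    fun q hq h => by have := hm q hq (by exact_mod_cast h); exact_mod_cast this
  exact depthCongruence N b m (σ := 3) hb hprime hp5 hwin (by norm_num) (by norm_num) hm' hne


/-! ## The coefficient form of the partial fractions -/

/-- **`PoleCoeffGser` is a theorem.** -/
theorem poleCoeffGser_holds : PoleCoeffGser := by
  intro b p q σ hb _hprime _hp5 hwin hq hσ1 hσ
  obtain ⟨hbox, hhalf, hpf, _hn⟩ := thmA_data b hb hwin
  have hm := mult_eq_netExp b q
  have hid := pf_eq_coeff_Gser b hbox hhalf hpf hq (show σ - 1 < 6 by omega)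
  rw [coeff_X_pow_mul', if_pos (by omega)] at hid
  have hκ : 5 - (σ - 1) - mult b q = (-netExp b q).toNat - σ := by omega
  rw [hid, hκ]

end Summit.KontsevichZagierPeriods.Zeta5Search.ClassDigitLaw

end
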